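import Summits.RiemannHypothesis.RiemannHypothesis.Theorems.TiltedLandingLaw421R3Lens1MeridianLocal

/-!
# IMAGE «Lens1MeridianGerm» v1 (lens-1 g12) — the MERIDIAN GERM and REGULAR DESCENT on crit-1's path-free object

On top of #180 «Lens1MeridianLocal» ((L1) `poleVerticalGraph`, (L2) `regularArc`, both PROVED there):
* `paySet f j T` = `{z ∈ closed upper half-disc of T | Re φ_j z = 0 ∧ 0 < Im φ_j z} ∪ {T}` and `meridianComponent f j T :=
  connectedComponentIn (paySet f j T) T` (crit-1's PATH-FREE meridian object, STATUS l.10684);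
* (L3) `meridian_germ`: below a simple zero `T` (`Im T > 0`) the vertical graph of (L1) lies in the meridian component, off `T`, with
  `Re φ = 0` and `Im φ ≥ 1/(4 (Im T − y))`; `meridianComponent_nontrivial`;
* (L4) `regular_descent`: at a point `z₀ ≠ T` of the component in the OPEN half-disc where `φ` is analytic with `φ′ z₀ ≠ 0`, the
  component contains a point with strictly smaller `Im φ` (the (L2) arc through `z₀` stays in the component) — so a minimiser of
  `Im φ` over the component is never an interior regular point;
* (L8) `mem_meridianComponent_of_mem_closure`: the component is closed in the pay set.
These are the first two rungs of the lift (G) `MeridianReach` of #172's (B1); (B1)/(B2), stub 1′ and ⟨27010⟩ stay OPEN; RH is not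
proved; nothing here asserts an open law.
-/

namespace RhW08.Lens1MeridianGerm

open Complex Set Metric RhW08.Lens1ArcSign RhW08.Lens1MeridianLocal

/-- crit-1's PATH-FREE object, the PAY SET of `T`: the points of `T`'s closed upper half-disc with `Re φ_j = 0` and `Im φ_j > 0`, plus `T`. -/
def paySet (f : ℂ → ℂ) (j : ℕ) (T : ℂ) : Set ℂ :=
  {z : ℂ | ((z.re - T.re) ^ 2 + z.im ^ 2 ≤ T.im ^ 2 ∧ 0 ≤ z.im) ∧ (phiAt f j z).re = 0 ∧ 0 < (phiAt f j z).im} ∪ {T}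

/-- the MERIDIAN COMPONENT of `T`: the connected component of `T` in its pay set (lens-1 NODE v37 §3). -/
def meridianComponent (f : ℂ → ℂ) (j : ℕ) (T : ℂ) : Set ℂ := connectedComponentIn (paySet f j T) T

/-- (L3) MERIDIAN GERM: by (L1) `poleVerticalGraph` (#180), for a simple upper zero `T` there are `0 < r < Im T` and a continuous `X` on `[Im T − r, Im T]`
with `X (Im T) = Re T` whose graph points `⟨X y, y⟩` (`Im T − r ≤ y < Im T`) all belong to the meridian component of `T`, are
`≠ T`, satisfy `Re φ = 0` and `Im φ ≥ 1/(4 (Im T − y))`. -/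
theorem meridian_germ (f : ℂ → ℂ) (j : ℕ) (T : ℂ) (hf : Differentiable ℂ f)
    (hT : iteratedDeriv j f T = 0) (hq : 0 < T.im) (hT' : iteratedDeriv (j + 1) f T ≠ 0) :
    ∃ r : ℝ, 0 < r ∧ r < T.im ∧ ∃ X : ℝ → ℝ, ContinuousOn X (Icc (T.im - r) T.im) ∧ X T.im = T.re ∧
      ∀ y : ℝ, T.im - r ≤ y → y < T.im →
        (⟨X y, y⟩ : ℂ) ∈ meridianComponent f j T ∧ (⟨X y, y⟩ : ℂ) ≠ T ∧ (phiAt f j ⟨X y, y⟩).re = 0 ∧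
          1 / (4 * (T.im - y)) ≤ (phiAt f j ⟨X y, y⟩).im := by
  obtain ⟨r, hr, X, hXc, hXT, hrows, -⟩ := poleVerticalGraph f j T hf hT hq hT'
  set r' := min r (T.im / 2) with hr'def
  have hr' : 0 < r' := lt_min hr (by linarith)
  have hr'r : r' ≤ r := min_le_left _ _
  have hr'q : r' < T.im := lt_of_le_of_lt (min_le_right _ _) (by linarith)
  have hXc' : ContinuousOn X (Icc (T.im - r') T.im) := hXc.mono (Icc_subset_Icc (by linarith) le_rfl)
  -- the graph curve and its image
  have hγ : ContinuousOn (fun y : ℝ => (⟨X y, y⟩ : ℂ)) (Icc (T.im - r') T.im) := by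
    have e : (fun y : ℝ => (⟨X y, y⟩ : ℂ)) = fun y => (X y : ℂ) + (y : ℂ) * I := by
      funext y; exact Complex.mk_eq_add_mul_I (X y) y
    rw [e]
    exact (Complex.continuous_ofReal.comp_continuousOn hXc').add
      ((Complex.continuous_ofReal.continuousOn).mul continuousOn_const)
  have hpre : IsPreconnected ((fun y : ℝ => (⟨X y, y⟩ : ℂ)) '' Icc (T.im - r') T.im) := isPreconnected_Icc.image _ hγ
  have hTmem : T ∈ (fun y : ℝ => (⟨X y, y⟩ : ℂ)) '' Icc (T.im - r') T.im :=
    ⟨T.im, ⟨by linarith, le_rfl⟩, by simp only [hXT]⟩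
  have hsub : (fun y : ℝ => (⟨X y, y⟩ : ℂ)) '' Icc (T.im - r') T.im ⊆ paySet f j T := by
    rintro z ⟨y, hy, rfl⟩
    rcases eq_or_lt_of_le hy.2 with heq | hlt
    · right; rw [Set.mem_singleton_iff]; subst heq
      show (⟨X T.im, T.im⟩ : ℂ) = T; rw [hXT]
    · obtain ⟨-, htan, hre, him, -⟩ := hrows y (by linarith [hy.1]) hlt
      left
      refine ⟨⟨?_, ?_⟩, hre, lt_of_lt_of_le (by positivity) him⟩
      · show (X y - T.re) ^ 2 + y ^ 2 ≤ T.im ^ 2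
        have hy0 : 0 ≤ y := by linarith [hy.1]
        have h1 : (X y - T.re) ^ 2 ≤ ((T.im - y) / 4) ^ 2 := by
          rw [← sq_abs]; exact pow_le_pow_left₀ (abs_nonneg _) htan 2
        nlinarith
      · show (0 : ℝ) ≤ y
        linarith [hy.1]
  have hcomp : (fun y : ℝ => (⟨X y, y⟩ : ℂ)) '' Icc (T.im - r') T.im ⊆ meridianComponent f j T :=
    hpre.subset_connectedComponentIn hTmem hsub
  refine ⟨r', hr', hr'q, X, hXc', hXT, fun y hy₁ hy₂ => ?_⟩
  obtain ⟨-, -, hre, him, -⟩ := hrows y (by linarith) hy₂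
  refine ⟨hcomp ⟨y, ⟨hy₁, hy₂.le⟩, rfl⟩, fun h => ?_, hre, him⟩
  have := congrArg Complex.im h; simp at this; linarith

/-- corollary: the meridian component of a simple upper zero is NON-TRIVIAL (crit-1 STATUS l.10684 (d)). -/
theorem meridianComponent_nontrivial (f : ℂ → ℂ) (j : ℕ) (T : ℂ) (hf : Differentiable ℂ f)
    (hT : iteratedDeriv j f T = 0) (hq : 0 < T.im) (hT' : iteratedDeriv (j + 1) f T ≠ 0) :
    ∃ z ∈ meridianComponent f j T, z ≠ T ∧ z.im < T.im := by
  obtain ⟨r, hr, hrq, X, -, -, hg⟩ := meridian_germ f j T hf hT hq hT'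
  obtain ⟨hmem, hne, -, -⟩ := hg (T.im - r / 2) (by linarith) (by linarith)
  exact ⟨_, hmem, hne, by show T.im - r / 2 < T.im; linarith⟩

/-- (L4) REGULAR DESCENT: by (L2) `regularArc` (#180), at a point `z₀ ≠ T` of the meridian component lying in the OPEN half-disc where `φ` is analytic
with `φ′(z₀) ≠ 0`, the component contains points with strictly SMALLER `Im φ` — so `inf Im φ` over the component is never attained at
an interior regular point (the engine of the lift (G): a minimiser is a critical point of `φ`, a zero of `f^{(j+1)}` (`Im φ → 0`),
a base point, or an arc point). -/
theorem regular_descent (f : ℂ → ℂ) (j : ℕ) (T z₀ : ℂ) (hz₀ : z₀ ∈ meridianComponent f j T) (hzT : z₀ ≠ T)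
    (hdisc : (z₀.re - T.re) ^ 2 + z₀.im ^ 2 < T.im ^ 2) (him₀ : 0 < z₀.im) (ha : AnalyticAt ℂ (phiAt f j) z₀)
    (hd : deriv (phiAt f j) z₀ ≠ 0) : ∃ z ∈ meridianComponent f j T, (phiAt f j z).im < (phiAt f j z₀).im := by
  have hpay : (phiAt f j z₀).re = 0 ∧ 0 < (phiAt f j z₀).im := by
    rcases connectedComponentIn_subset _ _ hz₀ with h | h
    · exact h.2
    · exact absurd (Set.mem_singleton_iff.mp h) hzT
  obtain ⟨r, ρ, -, hρ, Z, hZc, hZ₀, hZφ, -⟩ := regularArc (phiAt f j) z₀ ha hd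
  set t₀ := (phiAt f j z₀).im with ht₀
  -- the open half-disc is a neighbourhood of `z₀ = Z t₀`
  have hU : IsOpen {z : ℂ | (z.re - T.re) ^ 2 + z.im ^ 2 < T.im ^ 2 ∧ 0 < z.im} :=
    (isOpen_lt (((Complex.continuous_re.sub continuous_const).pow 2).add (Complex.continuous_im.pow 2)) continuous_const).inter
      (isOpen_lt continuous_const Complex.continuous_im)
  have hZat : ContinuousAt Z t₀ := hZc.continuousAt (Ioo_mem_nhds (by linarith) (by linarith))
  have hpre : Z ⁻¹' {z : ℂ | (z.re - T.re) ^ 2 + z.im ^ 2 < T.im ^ 2 ∧ 0 < z.im} ∈ nhds t₀ :=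
    hZat.preimage_mem_nhds (hU.mem_nhds (by rw [Set.mem_setOf_eq, hZ₀]; exact ⟨hdisc, him₀⟩))
  obtain ⟨δ, hδ, hδU⟩ := Metric.mem_nhds_iff.mp hpre
  set δ' := min δ (min ρ t₀) / 2 with hδ'def
  have hδ' : 0 < δ' := by have := lt_min hδ (lt_min hρ hpay.2); positivity
  have hδ'δ : δ' < δ := by
    have : min δ (min ρ t₀) ≤ δ := min_le_left _ _
    have h2 : 0 < min δ (min ρ t₀) := lt_min hδ (lt_min hρ hpay.2)
    rw [hδ'def]; linarith
  have hδ'ρ : δ' < ρ := by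
    have : min δ (min ρ t₀) ≤ ρ := (min_le_right _ _).trans (min_le_left _ _)
    have h2 : 0 < min δ (min ρ t₀) := lt_min hδ (lt_min hρ hpay.2)
    rw [hδ'def]; linarith
  have hδ't : δ' < t₀ := by
    have : min δ (min ρ t₀) ≤ t₀ := (min_le_right _ _).trans (min_le_right _ _)
    have h2 : 0 < min δ (min ρ t₀) := lt_min hδ (lt_min hρ hpay.2)
    rw [hδ'def]; linarith
  have hJ : Icc (t₀ - δ') t₀ ⊆ Ioo (t₀ - ρ) (t₀ + ρ) := fun t ht => ⟨by linarith [ht.1], by linarith [ht.2]⟩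
  have hconn : IsPreconnected (Z '' Icc (t₀ - δ') t₀) := isPreconnected_Icc.image _ (hZc.mono hJ)
  have hsub : Z '' Icc (t₀ - δ') t₀ ⊆ paySet f j T := by
    rintro z ⟨t, ht, rfl⟩
    have htU : Z t ∈ {z : ℂ | (z.re - T.re) ^ 2 + z.im ^ 2 < T.im ^ 2 ∧ 0 < z.im} :=
      hδU (by rw [Metric.mem_ball, Real.dist_eq, abs_lt]; constructor <;> linarith [ht.1, ht.2])
    have hφ := hZφ t (hJ ht)
    rw [hpay.1] at hφ
    left
    refine ⟨⟨htU.1.le, htU.2.le⟩, by rw [hφ], ?_⟩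
    rw [hφ]; show (0 : ℝ) < t; linarith [ht.1]
  have hz₀mem : z₀ ∈ Z '' Icc (t₀ - δ') t₀ := ⟨t₀, ⟨by linarith, le_rfl⟩, hZ₀⟩
  have hcomp : Z '' Icc (t₀ - δ') t₀ ⊆ meridianComponent f j T := by
    have h := hconn.subset_connectedComponentIn hz₀mem hsub
    unfold meridianComponent; rw [connectedComponentIn_eq hz₀]; exact h
  refine ⟨Z (t₀ - δ'), hcomp ⟨t₀ - δ', ⟨le_rfl, by linarith⟩, rfl⟩, ?_⟩
  have hφ := hZφ (t₀ - δ') (hJ ⟨le_rfl, by linarith⟩)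
  rw [hφ]; show t₀ - δ' < t₀; linarith

/-- (L8) the meridian component is CLOSED IN THE PAY SET: a pay point in the closure of the component belongs to it (so the limit of a
minimising sequence, once shown to be a pay point, is back in the component — the book-keeping step of the lift (G)). -/
theorem mem_meridianComponent_of_mem_closure (f : ℂ → ℂ) (j : ℕ) (T z : ℂ) (hz : z ∈ paySet f j T)
    (hcl : z ∈ closure (meridianComponent f j T)) : z ∈ meridianComponent f j T := by
  have hT : T ∈ paySet f j T := Or.inr rfl
  have hK : IsPreconnected (meridianComponent f j T) := isPreconnected_connectedComponentIn
  have hS : IsPreconnected (insert z (meridianComponent f j T)) :=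
    hK.subset_closure (Set.subset_insert _ _) (Set.insert_subset hcl subset_closure)
  exact hS.subset_connectedComponentIn (Set.mem_insert_of_mem _ (mem_connectedComponentIn hT))
    (Set.insert_subset hz (connectedComponentIn_subset _ _)) (Set.mem_insert _ _)

end RhW08.Lens1MeridianGerm
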